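import Summits.Parity.GeneralizedHardyLittlewood.Theorems.PrimeLevelFamEdgeMomentsBeyondDiagonalDiagBlockTail
import Summits.Parity.GeneralizedHardyLittlewood.Theorems.PrimeLevelFamEdgeMomentsBeyondDiagonalDictionaryAtOneBounds
import Literature.NumberTheory.LFunctions.KMVMomentsToHalfEdge
import Summits.Parity.GeneralizedHardyLittlewood.Theorems.PrimeLevelFamEdgeMomentsBeyondDiagonalFirstMomentAllQ
import Mathlib.Analysis.Complex.ExponentialBounds
import HarnessLib

/-!
# Route `PrimeLevelFamEdge`, crux K_A `MomentsBeyondDiagonal` (stmt-Parity-20007), line «petersson_layers» v4, stub `stub_diag`: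
# CENSUS R1 CLOSED — the AFE-box tail of the diagonal part is `O_{P,Q}(1)` on every window `0 < Δ' ≤ 3/2`

`…DiagBlockTail.norm_diagPart_sub_lineSeries_le` (p812024) bounds `‖diagPart − (explicit line series)‖` by
`Σ_{i,j ≤ deg Q} |QᵢQⱼ| ℓ^{−(i+j)} 2q̂ (Σ_m|x_m|τ(m))² M · C_A(i)C_A(j)(1+log q̂+2log M)^{i+j} ζ₂ (q̂²M²/q⁴)^A (q²+1)^{i+j+1}`.
Here every factor is made elementary (`ℓ ≥ 1`, `q̂ ≤ q`, `|x_m|τ(m) ≤ B_P M^{1/2}`, `M = q̂^{Δ'} ≤ q^{3/4}`, `1+log q̂+2log M ≤ 5q`,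
`q²+1 ≤ 2q²`, `q̂²M²/q⁴ ≤ q^{−3/2}`) and `A = 4 deg Q + 4` makes the powers of `q` cancel exactly:

* `norm_diagPart_sub_lineSeries_le_const` — **for all `P, Q` and `0 < Δ' ≤ 3/2` there is `C` with
  `‖diagPart q P Q Δ' − (explicit line series)‖ ≤ C` for every `q ≥ 400`.**

So for `stub_diag` the diagonal part IS its explicit line series (census R1 done); what remains is the main term of that series
(R2 Bose coefficients, R3 the five-variable Möbius sums, R4 assembly). Helper `--supports stmt-Parity-20007`; closes nothing;
K_A, K_B and the Parity summit are NOT proved; nothing about Landau–Siegel zeros.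
-/

noncomputable section

open scoped Real
open Complex Finset MeasureTheory Polynomial
open Literature.NumberTheory.LFunctions

namespace Summit.Parity.GeneralizedHardyLittlewood.Theorems.MomentsBeyondDiagonal.DiagLines

open Summit.Parity.GeneralizedHardyLittlewood.Theorems.PrimeLevelFamEdgeIdeaDeltas.PeterssonLayers (diagPart abs_eval_le_sum_abs_coeff)

/-- `Σ_{m ≤ M} |x_m| τ(m) ≤ B · M^{3/2}` for `M > 1`, `|P| ≤ B` on `[0,1]` (`|x_m| ≤ B m^{−1/2}`, `τ(m) ≤ m ≤ M`).
[cite: KowalskiMichelVanderKam2000, (9) p. 7 — derivation] -/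
theorem sum_abs_mollifierCoeff_mul_card_divisors_le {P : ℝ[X]} {B : ℝ} (hB : ∀ t ∈ Set.Icc (0 : ℝ) 1, |P.eval t| ≤ B)
    {M : ℝ} (hM : 1 < M) :
    ∑ m ∈ Icc 1 ⌊M⌋₊, |KMV2000.mollifierCoeff P M m| * (m.divisors.card : ℝ) ≤ B * M ^ (3 / 2 : ℝ) := by
  have hM0 : 0 < M := by linarith
  have hB0 : 0 ≤ B := (abs_nonneg _).trans (hB 0 ⟨le_rfl, zero_le_one⟩)
  have hterm : ∀ m ∈ Icc 1 ⌊M⌋₊, |KMV2000.mollifierCoeff P M m| * (m.divisors.card : ℝ) ≤ B * M ^ (1 / 2 : ℝ) := by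
    intro m hm
    have hx := KMV2000.abs_mollifierCoeff_le hB hM hm
    rw [KMV2000.mollifierCoeff]
    obtain ⟨hm1, hmM⟩ := Finset.mem_Icc.mp hm
    have hm0 : (0 : ℝ) < m := by exact_mod_cast hm1
    have hmM' : (m : ℝ) ≤ M := (Nat.cast_le.mpr hmM).trans (Nat.floor_le hM0.le)
    have hτ : (m.divisors.card : ℝ) ≤ m := by exact_mod_cast Nat.card_divisors_le_self m
    calc |(ArithmeticFunction.moebius m : ℝ) * ((KMV2000.psi m)⁻¹ * (m : ℝ) ^ (-(1 / 2 : ℝ)) *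
          P.eval (Real.log (M / m) / Real.log M))| * (m.divisors.card : ℝ)
        ≤ B * (m : ℝ) ^ (-(1 / 2 : ℝ)) * m := mul_le_mul hx hτ (Nat.cast_nonneg _) (by positivity)
      _ = B * (m : ℝ) ^ (1 / 2 : ℝ) := by
          rw [mul_assoc, show (m : ℝ) ^ (-(1 / 2 : ℝ)) * (m : ℝ) = (m : ℝ) ^ (-(1 / 2 : ℝ)) * (m : ℝ) ^ (1 : ℝ) by
            rw [Real.rpow_one], ← Real.rpow_add hm0]
          norm_num
      _ ≤ B * M ^ (1 / 2 : ℝ) := by gcongr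
  calc ∑ m ∈ Icc 1 ⌊M⌋₊, |KMV2000.mollifierCoeff P M m| * (m.divisors.card : ℝ)
      ≤ ∑ m ∈ Icc 1 ⌊M⌋₊, B * M ^ (1 / 2 : ℝ) := Finset.sum_le_sum hterm
    _ = (⌊M⌋₊ : ℝ) * (B * M ^ (1 / 2 : ℝ)) := by simp
    _ ≤ M * (B * M ^ (1 / 2 : ℝ)) := by gcongr; exact Nat.floor_le hM0.le
    _ = B * M ^ (3 / 2 : ℝ) := by
        rw [show M ^ (3 / 2 : ℝ) = M ^ (1 : ℝ) * M ^ (1 / 2 : ℝ) by rw [← Real.rpow_add hM0]; norm_num, Real.rpow_one]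
        ring

/-- Pure bookkeeping for one `(i,j)` term of the box-tail bound: with `A = 4N+4` the powers of `q` cancel. -/
theorem term_bound_aux {Qi Qj linv Qh SM C Li Lj Z R E B q : ℝ} {N : ℕ}
    (hQi : 0 ≤ Qi) (hQj : 0 ≤ Qj) (hQh0 : 0 ≤ Qh) (hSM0 : 0 ≤ SM) (hC0 : 0 ≤ C)
    (hL0 : 0 ≤ Li * Lj) (hZ0 : 0 ≤ Z) (hR0 : 0 ≤ R) (hE0 : 0 ≤ E) (hq : 0 < q)
    (f1 : linv ≤ 1) (fQ : Qh ≤ q) (f2 : SM ≤ B ^ 2 * q ^ 3) (f4 : Li * Lj ≤ (5 : ℝ) ^ (2 * N) * q ^ (2 * N))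
    (f5 : R ≤ (q ^ (6 * N + 6))⁻¹) (f6 : E ≤ (2 : ℝ) ^ (2 * N + 1) * q ^ (4 * N + 2)) :
    Qi * Qj * linv * 2 * Qh * (SM * (C * Li * Lj * Z * R * E)) ≤
      Qi * Qj * 2 * B ^ 2 * C * (5 : ℝ) ^ (2 * N) * Z * (2 : ℝ) ^ (2 * N + 1) := by
  have hpre : 0 ≤ Qi * Qj * 2 * C * Z := by positivity
  have hkey : q * q ^ 3 * q ^ (2 * N) * (q ^ (6 * N + 6))⁻¹ * q ^ (4 * N + 2) = 1 := by
    rw [show q * q ^ 3 * q ^ (2 * N) * (q ^ (6 * N + 6))⁻¹ * q ^ (4 * N + 2) =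
      (q * q ^ 3 * q ^ (2 * N) * q ^ (4 * N + 2)) * (q ^ (6 * N + 6))⁻¹ by ring,
      show q * q ^ 3 * q ^ (2 * N) * q ^ (4 * N + 2) = q ^ (6 * N + 6) by ring,
      mul_inv_cancel₀ (pow_ne_zero _ hq.ne')]
  calc Qi * Qj * linv * 2 * Qh * (SM * (C * Li * Lj * Z * R * E))
      = Qi * Qj * 2 * C * Z * linv * Qh * SM * (Li * Lj) * R * E := by ring
    _ ≤ Qi * Qj * 2 * C * Z * 1 * q * (B ^ 2 * q ^ 3) * ((5 : ℝ) ^ (2 * N) * q ^ (2 * N)) *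
          (q ^ (6 * N + 6))⁻¹ * ((2 : ℝ) ^ (2 * N + 1) * q ^ (4 * N + 2)) := by
        gcongr
    _ = Qi * Qj * 2 * B ^ 2 * C * (5 : ℝ) ^ (2 * N) * Z * (2 : ℝ) ^ (2 * N + 1) *
          (q * q ^ 3 * q ^ (2 * N) * (q ^ (6 * N + 6))⁻¹ * q ^ (4 * N + 2)) := by ring
    _ = _ := by rw [hkey, mul_one]

set_option maxHeartbeats 800000 in
/-- **CENSUS R1 CLOSED: the box tail of the diagonal part is bounded.** For all real polynomials `P, Q` and every
`0 < Δ' ≤ 3/2` there is `C` such that for every level `q ≥ 400` (`M = q̂^{Δ'}`, notation of `…DiagLineSeries`):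
`‖diagPart q P Q Δ' − Σ_{i,j} QᵢQⱼℓ^{−(i+j)}(1+(−1)^{i+j}) q̂ Σ_{m₁,m₂≤M} x_{m₁}x_{m₂} Σ_{d₁∣m₁,d₂∣m₂} c (m₁m₂)^{−1/2} 𝔚_{ij}(A₁,A₂;K/q̂²)‖ ≤ C`.
[cite: KowalskiMichelVanderKam2000, (22)–(23) p. 12–13 — derivation] -/
theorem norm_diagPart_sub_lineSeries_le_const (P Q : ℝ[X]) {Δ' : ℝ} (h0 : 0 < Δ') (h32 : Δ' ≤ 3 / 2) :
    ∃ C : ℝ, ∀ (q : ℕ) [NeZero q], 400 ≤ q →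
      ‖diagPart q P Q Δ' -
        ∑ i ∈ range (Q.natDegree + 1), ∑ j ∈ range (Q.natDegree + 1),
          (Q.coeff i : ℂ) * (Q.coeff j : ℂ) * (((Real.log (KMV2000.qhat q))⁻¹ : ℝ) : ℂ) ^ (i + j) *
            (1 + (-1 : ℂ) ^ (i + j)) * (KMV2000.qhat q : ℂ) *
          ∑ m₁ ∈ Icc 1 ⌊KMV2000.qhat q ^ Δ'⌋₊, ∑ m₂ ∈ Icc 1 ⌊KMV2000.qhat q ^ Δ'⌋₊,
            (KMV2000.mollifierCoeff P (KMV2000.qhat q ^ Δ') m₁ : ℂ) *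
              (KMV2000.mollifierCoeff P (KMV2000.qhat q ^ Δ') m₂ : ℂ) *
            ∑ d₁ ∈ m₁.divisors, ∑ d₂ ∈ m₂.divisors,
              (((((m₁ / d₁).gcd (m₂ / d₂) : ℝ) * ((m₁ : ℝ) * m₂) ^ (-(1 / 2 : ℝ)) *
                (∫ u₁ in Set.Ioi (0 : ℝ),
                  (Real.log (KMV2000.qhat q / ((d₁ * (m₂ / d₂ / (m₁ / d₁).gcd (m₂ / d₂)) : ℕ) : ℝ)) + Real.log u₁) ^ i *
                  ∫ u₂ in Set.Ioi (((((m₁ / (m₁ / d₁).gcd (m₂ / d₂)) * (m₂ / (m₁ / d₁).gcd (m₂ / d₂)) : ℕ) : ℝ) /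
                      KMV2000.qhat q ^ 2) / u₁),
                    Real.exp (-(u₁ + u₂)) / (1 - Real.exp (-(u₁ + u₂))) ^ 2 *
                    (Real.log (KMV2000.qhat q / ((d₂ * (m₁ / d₁ / (m₁ / d₁).gcd (m₂ / d₂)) : ℕ) : ℝ)) + Real.log u₂) ^ j)) : ℝ) : ℂ)‖
        ≤ C := by
  set N : ℕ := Q.natDegree with hN
  set A : ℝ := 4 * N + 4 with hAdef
  have hA : (2 * Q.natDegree + 1 : ℝ) ≤ 2 * A := by rw [hAdef, hN]; nlinarith [(Nat.cast_nonneg N : (0:ℝ) ≤ N)]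
  have hA0 : 0 ≤ A := by rw [hAdef]; positivity
  set B : ℝ := ∑ c ∈ range (P.natDegree + 1), |P.coeff c| with hBdef
  have hB : ∀ t ∈ Set.Icc (0 : ℝ) 1, |P.eval t| ≤ B :=
    fun t ht ↦ abs_eval_le_sum_abs_coeff P ht
  have hB0 : 0 ≤ B := Finset.sum_nonneg fun c _ ↦ abs_nonneg _
  -- the per-order constants
  set Cij : ℕ → ℕ → ℝ := fun i j ↦ (∫ t in Set.Ioi (0 : ℝ), t ^ A * (Real.exp (-t) * (2 ^ i * (1 + |Real.log t| ^ i)))) *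
    ∫ t in Set.Ioi (0 : ℝ), t ^ A * (Real.exp (-t) * (2 ^ j * (1 + |Real.log t| ^ j))) with hCij
  have hCij0 : ∀ i j, 0 ≤ Cij i j := by
    intro i j
    have h1 : 0 ≤ ∫ t in Set.Ioi (0 : ℝ), t ^ A * (Real.exp (-t) * (2 ^ i * (1 + |Real.log t| ^ i))) :=
      setIntegral_nonneg measurableSet_Ioi fun t ht ↦ by have ht : (0 : ℝ) < t := ht; positivity
    have h2 : 0 ≤ ∫ t in Set.Ioi (0 : ℝ), t ^ A * (Real.exp (-t) * (2 ^ j * (1 + |Real.log t| ^ j))) :=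
      setIntegral_nonneg measurableSet_Ioi fun t ht ↦ by have ht : (0 : ℝ) < t := ht; positivity
    exact mul_nonneg h1 h2
  set Z : ℝ := ∑' n : ℕ, (((n : ℝ) + 1) ^ 2)⁻¹ with hZ
  have hZ0 : 0 ≤ Z := tsum_nonneg fun n ↦ by positivity
  refine ⟨∑ i ∈ range (N + 1), ∑ j ∈ range (N + 1),
      |Q.coeff i| * |Q.coeff j| * 2 * B ^ 2 * Cij i j * (5 : ℝ) ^ (2 * N) * Z * (2 : ℝ) ^ (2 * N + 1), fun q _ hq ↦ ?_⟩
  -- level facts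
  have hQ3 : 3 ≤ KMV2000.qhat q := FirstOrderAFE.three_le_qhat hq
  have hstruct := norm_diagPart_sub_lineSeries_le (le_trans (by norm_num) hQ3) P Q h0.le hA
  set Qh : ℝ := KMV2000.qhat q with hQh
  have hQ1 : 1 ≤ Qh := by linarith
  have hQ0 : 0 < Qh := by linarith
  have hq1 : (1 : ℝ) ≤ q := by exact_mod_cast (show 1 ≤ q by omega)
  have hq0 : (0 : ℝ) < q := by linarith
  have hQq : Qh ≤ (q : ℝ) := by
    calc Qh ≤ Real.sqrt q := KMV2000.qhat_le_sqrt
      _ ≤ (q : ℝ) := by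
          rw [Real.sqrt_le_left (by linarith)]
          nlinarith
  have hQsq : Qh ^ 2 ≤ (q : ℝ) := by
    calc Qh ^ 2 ≤ Real.sqrt q ^ 2 := pow_le_pow_left₀ hQ0.le KMV2000.qhat_le_sqrt 2
      _ = q := Real.sq_sqrt hq0.le
  set ℓ : ℝ := Real.log Qh with hℓ
  have hℓ1 : 1 ≤ ℓ := by
    rw [hℓ, ← Real.log_exp 1]
    refine Real.log_le_log (Real.exp_pos 1) ?_
    have := Real.exp_one_lt_d9
    linarith
  have hℓ0 : 0 < ℓ := by linarith
  have hℓQ : ℓ ≤ Qh := by have := Real.log_le_sub_one_of_pos hQ0; rw [hℓ]; linarith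
  set M : ℝ := Qh ^ Δ' with hMdef
  have hM1 : 1 < M := Real.one_lt_rpow (by linarith) h0
  have hM0 : 0 < M := by linarith
  have hMq : M ≤ (q : ℝ) ^ (3 / 4 : ℝ) := by
    calc M ≤ Qh ^ (3 / 2 : ℝ) := Real.rpow_le_rpow_of_exponent_le hQ1 h32
      _ ≤ (Real.sqrt q) ^ (3 / 2 : ℝ) := Real.rpow_le_rpow hQ0.le KMV2000.qhat_le_sqrt (by norm_num)
      _ = (q : ℝ) ^ (3 / 4 : ℝ) := by rw [Real.sqrt_eq_rpow, ← Real.rpow_mul hq0.le]; norm_num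
  have hlogM : Real.log M = Δ' * ℓ := by rw [hMdef, Real.log_rpow hQ0]
  clear_value M ℓ Qh
  -- the structural bound
  refine hstruct.trans (Finset.sum_le_sum fun i hi ↦ Finset.sum_le_sum fun j hj ↦ ?_)
  have hi' : i ≤ N := Nat.lt_succ_iff.mp (Finset.mem_range.mp hi)
  have hj' : j ≤ N := Nat.lt_succ_iff.mp (Finset.mem_range.mp hj)
  -- elementary factor bounds
  have f1 : ℓ⁻¹ ^ (i + j) ≤ 1 := pow_le_one₀ (inv_nonneg.mpr hℓ0.le) (inv_le_one_of_one_le₀ hℓ1)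
  have f2 : (∑ m ∈ Icc 1 ⌊M⌋₊, |KMV2000.mollifierCoeff P M m| * (m.divisors.card : ℝ)) ^ 2 * M ≤ B ^ 2 * (q : ℝ) ^ 3 := by
    have hS := sum_abs_mollifierCoeff_mul_card_divisors_le hB hM1
    have hS0 : 0 ≤ ∑ m ∈ Icc 1 ⌊M⌋₊, |KMV2000.mollifierCoeff P M m| * (m.divisors.card : ℝ) :=
      Finset.sum_nonneg fun m _ ↦ mul_nonneg (abs_nonneg _) (Nat.cast_nonneg _)
    have hM4 : M ^ (3 / 2 : ℝ) * M ^ (3 / 2 : ℝ) * M ≤ (q : ℝ) ^ 3 := by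
      have e : M ^ (3 / 2 : ℝ) * M ^ (3 / 2 : ℝ) * M = M ^ (4 : ℝ) := by
        rw [← Real.rpow_add hM0, show M ^ (3 / 2 + 3 / 2 : ℝ) * M = M ^ (3 / 2 + 3 / 2 : ℝ) * M ^ (1 : ℝ) by
          rw [Real.rpow_one], ← Real.rpow_add hM0]; norm_num
      rw [e]
      calc M ^ (4 : ℝ) ≤ ((q : ℝ) ^ (3 / 4 : ℝ)) ^ (4 : ℝ) := Real.rpow_le_rpow hM0.le hMq (by norm_num)
        _ = (q : ℝ) ^ 3 := by rw [← Real.rpow_mul hq0.le]; norm_num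
    calc (∑ m ∈ Icc 1 ⌊M⌋₊, |KMV2000.mollifierCoeff P M m| * (m.divisors.card : ℝ)) ^ 2 * M
        ≤ (B * M ^ (3 / 2 : ℝ)) ^ 2 * M := mul_le_mul_of_nonneg_right (pow_le_pow_left₀ hS0 hS 2) hM0.le
      _ = B ^ 2 * (M ^ (3 / 2 : ℝ) * M ^ (3 / 2 : ℝ) * M) := by rw [mul_pow, sq (M ^ (3 / 2 : ℝ)), mul_assoc]
      _ ≤ B ^ 2 * (q : ℝ) ^ 3 := mul_le_mul_of_nonneg_left hM4 (sq_nonneg B)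
  have f3 : (1 + ℓ + 2 * Real.log M) ≤ 5 * (q : ℝ) := by
    rw [hlogM]
    nlinarith
  have f3' : 0 ≤ 1 + ℓ + 2 * Real.log M := by
    rw [hlogM]; nlinarith [hℓ0, h0]
  have f4 : (1 + ℓ + 2 * Real.log M) ^ i * (1 + ℓ + 2 * Real.log M) ^ j ≤
      (5 : ℝ) ^ (2 * N) * (q : ℝ) ^ (2 * N) := by
    rw [← pow_add, ← mul_pow]
    calc (1 + ℓ + 2 * Real.log M) ^ (i + j) ≤ (5 * (q : ℝ)) ^ (i + j) := pow_le_pow_left₀ f3' f3 _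
      _ ≤ (5 * (q : ℝ)) ^ (2 * N) := pow_le_pow_right₀ (by linarith) (by omega)
  have f5 : (Qh ^ 2 * M ^ 2 / ((q : ℝ)) ^ 4) ^ A ≤ (((q : ℝ)) ^ (6 * N + 6))⁻¹ := by
    have hbase : Qh ^ 2 * M ^ 2 / ((q : ℝ)) ^ 4 ≤ (q : ℝ) ^ (-(3 / 2 : ℝ)) := by
      have hM2 : M ^ 2 ≤ (q : ℝ) ^ (3 / 2 : ℝ) := by
        calc M ^ 2 ≤ ((q : ℝ) ^ (3 / 4 : ℝ)) ^ 2 := pow_le_pow_left₀ hM0.le hMq 2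
          _ = (q : ℝ) ^ (3 / 2 : ℝ) := by rw [← Real.rpow_natCast, ← Real.rpow_mul hq0.le]; norm_num
      calc Qh ^ 2 * M ^ 2 / ((q : ℝ)) ^ 4 ≤ (q : ℝ) * (q : ℝ) ^ (3 / 2 : ℝ) / ((q : ℝ)) ^ 4 := by gcongr
        _ = (q : ℝ) ^ (-(3 / 2 : ℝ)) := by
            rw [show (q : ℝ) * (q : ℝ) ^ (3 / 2 : ℝ) = (q : ℝ) ^ (1 : ℝ) * (q : ℝ) ^ (3 / 2 : ℝ) by rw [Real.rpow_one],
              ← Real.rpow_add hq0, show ((q : ℝ)) ^ 4 = (q : ℝ) ^ (4 : ℝ) by rw [← Real.rpow_natCast]; norm_num,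
              ← Real.rpow_sub hq0]
            norm_num
    calc (Qh ^ 2 * M ^ 2 / ((q : ℝ)) ^ 4) ^ A ≤ ((q : ℝ) ^ (-(3 / 2 : ℝ))) ^ A :=
          Real.rpow_le_rpow (by positivity) hbase hA0
      _ = (((q : ℝ)) ^ (6 * N + 6))⁻¹ := by
          rw [← Real.rpow_mul hq0.le, hAdef, show (-(3 / 2 : ℝ)) * (4 * N + 4) = -((6 * N + 6 : ℕ) : ℝ) by push_cast; ring,
            Real.rpow_neg hq0.le, Real.rpow_natCast]
  have f6 : (((q : ℝ)) ^ 2 + 1) ^ ((i + j : ℝ) + 1) ≤ (2 : ℝ) ^ (2 * N + 1) * (q : ℝ) ^ (4 * N + 2) := by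
    have hb : ((q : ℝ)) ^ 2 + 1 ≤ 2 * (q : ℝ) ^ 2 := by nlinarith
    have hb1 : (1 : ℝ) ≤ ((q : ℝ)) ^ 2 + 1 := by nlinarith
    calc (((q : ℝ)) ^ 2 + 1) ^ ((i + j : ℝ) + 1) ≤ (((q : ℝ)) ^ 2 + 1) ^ ((2 * N + 1 : ℕ) : ℝ) := by
          refine Real.rpow_le_rpow_of_exponent_le hb1 ?_
          have : (i : ℝ) ≤ N := by exact_mod_cast hi'
          have : (j : ℝ) ≤ N := by exact_mod_cast hj'
          push_cast; linarith
      _ = (((q : ℝ)) ^ 2 + 1) ^ (2 * N + 1) := Real.rpow_natCast _ _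
      _ ≤ (2 * (q : ℝ) ^ 2) ^ (2 * N + 1) := pow_le_pow_left₀ (by positivity) hb _
      _ = (2 : ℝ) ^ (2 * N + 1) * (q : ℝ) ^ (4 * N + 2) := by rw [mul_pow, ← pow_mul]; ring_nf
  -- assemble
  have hS0 : 0 ≤ (∑ m ∈ Icc 1 ⌊M⌋₊, |KMV2000.mollifierCoeff P M m| * (m.divisors.card : ℝ)) ^ 2 * M :=
    mul_nonneg (sq_nonneg _) hM0.le
  have hL0 : 0 ≤ (1 + ℓ + 2 * Real.log M) ^ i * (1 + ℓ + 2 * Real.log M) ^ j :=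
    mul_nonneg (pow_nonneg f3' _) (pow_nonneg f3' _)
  have hR0 : 0 ≤ (Qh ^ 2 * M ^ 2 / ((q : ℝ)) ^ 4) ^ A :=
    Real.rpow_nonneg (div_nonneg (mul_nonneg (sq_nonneg _) (sq_nonneg _)) (pow_nonneg hq0.le _)) _
  have hE0 : 0 ≤ (((q : ℝ)) ^ 2 + 1) ^ ((i + j : ℝ) + 1) := Real.rpow_nonneg (by positivity) _
  exact term_bound_aux (abs_nonneg _) (abs_nonneg _) hQ0.le hS0 (hCij0 i j)
    hL0 hZ0 hR0 hE0 hq0 f1 hQq f2 f4 f5 f6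

end Summit.Parity.GeneralizedHardyLittlewood.Theorems.MomentsBeyondDiagonal.DiagLines

end
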